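import Summits.CriticalPhenomena.PercolationContinuityZ3.Theorems.Transplant.KNLevelsZdRegression
import Summits.CriticalPhenomena.PercolationContinuityZ3.Theorems.Transplant.KNLevelsHGluing
import Literature.Probability.Percolation.KozmaNitzanCorridor
import HarnessLib

/-!
# BRIDGE `ℤ^d`: the target property OVER LEVELS implies Kozma–Nitzan's original target property on `ℤ^d` — hence KN's Lemma 11 (elongated
# boxes hittable) and Lemma 12 (the corridor) on `ℤ^d` follow from the GENERIC levels layer, and hold UNCONDITIONALLY

builds on p205010 (kernel theorem, internal audit signed; external expert review pending) — nothing in this file uses p205010 (the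
unconditional `ℤ^d` target property is already the tree's `Quant.targetProperty_of_theta_pos`; with `KNLevels.targetProperty_zdGraph_KN` of
`KNLevelsTargetPropertyKN.lean` the bridge below gives it a second, generic-route proof).
Lane `prim-bschramm`, seat `prim-bschramm-stmt` (regression programme, lead V39/08:19Z: "then the ℤ^d regression of the corridor lemma").

* **`targetPropertyZd_of_levels`** — `0 < p < 1`, `θ(p) > 0`: `KNLevels.TargetProperty (zdGraph d) (2d) p → KozmaNitzan.TargetProperty d p`
  (the kit construction of `KNLevelsZdRegression.lean` — `zdSeedKit` at every level of the window, shells, Step-IV estimates from Lemma 7 /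
  Lemma 9 / the hittable target routes — with the accuracy `δ` now supplied by the levels property instead of the assembly);
* **`corridorLemma_of_levels`** — KN's Lemma 12 on `ℤ^d` (`CData.corridorLemma_of_target`'s exact conclusion) from the levels property;
  **`isHittable_elongGeom_of_levels`**, `isHittable_of_mem_elongList_of_levels` — KN's Lemma 11 from the levels property: the `ℤ^d` REGRESSION
  of Lemmas 11–12 through the generic route (the original proofs of Lemmas 11–12 consume only `TargetProperty d p`);
[cite: KozmaNitzan2024, §4 Lemma 10 (pp. 17–22), Lemma 11 (p. 22), Lemma 12 (pp. 23–25)]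
-/

noncomputable section

open MeasureTheory ProbabilityTheory
open scoped ENNReal

namespace Summit.CriticalPhenomena.PercolationContinuityZ3.Theorems

namespace Transplant

open Literature.Probability.Percolation Literature.Probability.Percolation.KozmaNitzan Literature.Probability.LatticeModels SimpleGraph

variable {d : ℕ}

/-- **The levels target property gives Kozma–Nitzan's target property on `ℤ^d`** (`0 < p < 1`, `θ(p) > 0`): for every finite family of hittable
geometries the `ℤ^d` seed kits, shells and Step-IV estimates at every level of a long enough window feed `KNLevels.TargetProperty (zdGraph d) (2d) p`.
[cite: KozmaNitzan2024, §4 Lemma 10 (pp. 17–22)] -/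
theorem targetPropertyZd_of_levels [NeZero d] (p : unitInterval) (hp0 : 0 < (p : ℝ)) (hp1 : (p : ℝ) < 1)
    (hθ : 0 < theta (zdGraph d) 0 p) (hT : KNLevels.TargetProperty (zdGraph d) (2 * d) p) : TargetProperty d p := by
  classical
  intro ε hε
  -- the levels property supplies `δ` (Step I, part 1)
  obtain ⟨δ, hδpos, hδ1, hTL⟩ := hT hε
  refine ⟨δ, hδpos, fun H hH => ?_⟩
  -- Step I, part 2: the scales `m`, `M` (exactly as in the original)
  have hη : 0 < δ ^ 2 := by positivity
  have hkl : ∀ g ∈ H, ∃ kl : ℕ × ℕ, ∀ m, kl.1 ≤ m → ∀ ℓ, kl.2 ≤ ℓ →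
      1 - δ ^ 2 < (bondPercolation (zdGraph d) p).real (linkIn (↑(g.Qset ℓ 0)) (box d m) (g.Fset ℓ 0)) := by
    intro g hg
    obtain ⟨k, ℓ₀, h⟩ := (hH g hg).hit (δ ^ 2) hη
    exact ⟨(k, ℓ₀), h⟩
  choose! kl hklspec using hkl
  have le_foldr_max_of_mem : ∀ {l : List ℕ} {a : ℕ}, a ∈ l → a ≤ l.foldr max 0 := by
    intro l
    induction l with
    | nil => intro a h; exact absurd h List.not_mem_nil
    | cons b l ih =>
      intro a h
      rw [List.foldr_cons]
      rcases List.mem_cons.1 h with rfl | h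
      · exact le_max_left _ _
      · exact (ih h).trans (le_max_right _ _)
  set k₀ := (H.map fun g => (kl g).1).foldr max 0 with hk₀
  set ℓmax := (H.map fun g => (kl g).2).foldr max 0 with hℓmax
  have hk₀le : ∀ g ∈ H, (kl g).1 ≤ k₀ := fun g hg => le_foldr_max_of_mem (List.mem_map.2 ⟨g, hg, rfl⟩)
  have hℓle : ∀ g ∈ H, (kl g).2 ≤ ℓmax := fun g hg => le_foldr_max_of_mem (List.mem_map.2 ⟨g, hg, rfl⟩)
  obtain ⟨m, hmk₀, n₁, hmn₁, hface⟩ := exists_forall_lt_real_linked_orthantFace p hθ hp1 hη k₀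
  obtain ⟨n₂, huniq⟩ := exists_forall_le_lt_real_uniqZone p m hη
  set M := max n₁ n₂ with hM
  have hmM : m ≤ M := (le_of_lt hmn₁).trans (le_max_left _ _)
  have hmM' : m < M := hmn₁.trans_le (le_max_left _ _)
  -- the number of seeds `k`, of contacts `N`, of levels
  set q : ℝ := 1 - (p : ℝ) ^ seedBound d M with hq
  have hq0 : 0 ≤ q := by rw [hq, sub_nonneg]; exact pow_le_one₀ p.2.1 p.2.2
  have hq1 : q < 1 := by rw [hq]; linarith [pow_pos hp0 (seedBound d M)]
  obtain ⟨k, hk⟩ := exists_pow_lt_of_lt_one hδpos hq1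
  set N := LData.Ncont d M k with hN
  set K₀ : ℝ := 1 / (1 - (p : ℝ)) ^ (2 * d * N) with hK₀
  set Lcount : ℕ := ⌈K₀ / δ⌉₊ + 1 with hLcount
  set j₀ : ℕ := 2 * M + 2 with hj₀
  set j₁ : ℕ := j₀ + Lcount - 1 with hj₁
  set R : ℕ := j₁ + M + ℓmax + 2 with hR
  refine ⟨R, fun W Sfin D lo hi T o hfin hsub hDS ho hoD hBR htgt hTD hTne hreach => ?_⟩
  set μ := prodBernoulli W with hμ
  -- `lo ≤ hi`, else `B = ∅`
  have hlohi : lo ≤ hi := by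
    by_contra hlt
    have : Finset.Icc lo hi = ∅ := Finset.Icc_eq_empty hlt
    rw [this] at hreach
    simp only [Finset.notMem_empty, Set.iUnion_of_empty, Set.iUnion_empty, measureReal_empty] at hreach
    linarith
  -- the level data: KN's, and the generic one on the levels `B⟨j⟩`
  set L : LData d := ⟨lo, hi, o, Sfin⟩ with hLdef
  have hL : LHyp L W p D (R - 1) :=
    { sub := hsub
      fin := hfin
      DS := hDS
      encl := by
        have : R - 1 + 1 = R := by omega
        rw [this]; exact hBR
      o_not := hoD
      o_mem := ho }
  have hL' : KNLevels.LHyp (KNLevels.zdLevels L) W p D (R - 1) := KNLevels.lhyp_zd hL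
  -- the count of levels
  have hj₁R : j₁ ≤ R - 1 := by omega
  have hcard : ((Finset.Icc j₀ j₁).card : ℝ) = Lcount := by
    rw [Nat.card_Icc]; congr 1; omega
  have hJ : 1 / (1 - (p : ℝ)) ^ (2 * d * N) ≤ δ * ((Finset.Icc j₀ j₁).card : ℝ) := by
    rw [hcard, hLcount]
    push_cast
    have h1 : K₀ / δ ≤ ⌈K₀ / δ⌉₊ := Nat.le_ceil _
    have h2 : K₀ = δ * (K₀ / δ) := by field_simp
    rw [← hK₀]
    nlinarith
  -- `{o ↔ B}` is the generic `reachB`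
  have hX0 : (KNLevels.zdLevels L).X 0 = Finset.Icc lo hi := by
    simp [KNLevels.zdLevels_X, hLdef]
  have hreach' : 1 - δ < μ.real (KNLevels.zdLevels L).reachB := by
    unfold KNLevels.LData.reachB
    rw [hX0]; exact hreach
  -- the kits at every level of the window
  refine hTL (KNLevels.zdLevels L) W D T (R - 1) N j₀ j₁ hL' hj₁R hTD hTne hJ (fun j hjJ => ?_) hreach'
  obtain ⟨hj₀j, hjj₁⟩ := Finset.mem_Icc.1 hjJ
  have hjR : j ≤ R - 1 := hjj₁.trans hj₁R
  have hjM : 2 * M + 2 ≤ j := hj₀j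
  have hwide : ∀ k', L.Lo j k' + 2 * M + 2 ≤ L.Hi j k' := by
    intro k'
    simp only [LData.Lo, LData.Hi, Pi.sub_apply, Pi.add_apply, Pi.natCast_apply]
    have : L.lo k' ≤ L.hi k' := hlohi k'
    omega
  -- the shell
  set S := L.X (j - 1) \ L.X (j - (2 * M + 2)) with hSdef
  have hS : S ⊆ Finset.Icc (L.Lo j + 1) (L.Hi j - 1) := LData.shell_subset_shrink (by omega)
  have hSX : S ⊆ (KNLevels.zdLevels L).X j := (Finset.sdiff_subset).trans (Icc_enlarge_mono (show j - 1 ≤ j by omega))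
  have hSD : S ⊆ D := (Finset.sdiff_subset).trans (hL.X_subset_D (by omega))
  -- the faces lie in the shell
  have hUS : ∀ x ∈ outerBoundary (zdGraph d) (L.X j), L.ufaceX j M x ⊆ S := by
    intro x hx
    obtain ⟨h, -⟩ := LData.winData_spec hwide hx
    refine (uface_subset_cube h).trans ?_
    change L.cubeX j M x ⊆ S
    rw [LData.cubeX_eq_ball]
    exact LData.ball_vX_subset_shell hjM hwide hx
  -- Step IV at every contact vertex: a relay reliable to `T` inside `D` (verbatim from the original)
  have hIV : ∀ x ∈ outerBoundary (zdGraph d) (L.X j),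
      1 - 3 * δ ≤ μ.real {ω | ∃ u ∈ L.ufaceX j M x,
        1 - δ < (prodBernoulli (pinW W (wireSet (↑S : Set (Site d))) ω)).real
          (⋃ t ∈ T, openConnIn (↑D : Set (Site d)) u t)} := by
    intro x hx
    set v := L.vX j M x with hv
    have hballS : GM.ball v M ⊆ S := LData.ball_vX_subset_shell hjM hwide hx
    have hballD : (↑(GM.ball v M) : Set (Site d)) ⊆ ↑D := Finset.coe_subset.2 (hballS.trans hSD)
    -- the target route from `v`
    have hvB : v ∈ Finset.Icc (lo - (R : Site d)) (hi + (R : Site d)) := by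
      have := LData.vX_mem (L := L) (by omega) hwide hx
      exact Icc_enlarge_mono (show j - 1 ≤ R by omega) this
    obtain ⟨ℓ, hRℓ, g, hg, hQ, hF⟩ := htgt.hit v hvB
    have hMℓ : M < ℓ := lt_of_lt_of_le (by omega) hRℓ
    -- (1) uniqueness zone
    have h1 : 1 - δ ^ 2 < μ.real (uniqZoneAt v m M) := by
      rw [hμ, hsub.real_eq_bondPercolation (determinedBy_uniqZoneAt v m M (wireSet_mono hballD))
        (measurableSet_uniqZoneAt v m M), real_uniqZoneAt_eq]
      exact huniq M (le_max_right _ _)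
    -- (2) the face
    have h2 : 1 - δ ^ 2 < μ.real (linkIn (↑(GM.ball v M)) (GM.ball v m) (L.ufaceX j M x)) := by
      obtain ⟨a, τ, hsubU⟩ := LData.orthantFace_image_subset_ufaceX hwide hx
      have hmono : linkIn (↑(GM.ball v M)) (GM.ball v m) ((orthantFace a τ M).image (· + v)) ⊆
          linkIn (↑(GM.ball v M)) (GM.ball v m) (L.ufaceX j M x) := linkIn_mono le_rfl le_rfl hsubU
      refine lt_of_lt_of_le ?_ (measureReal_mono hmono)
      rw [hμ, hsub.real_eq_bondPercolation (determinedBy_linkIn _ _ _ (wireSet_mono hballD))]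
      · have e1 : GM.ball v M = (box d M).image (· + v) := rfl
        have e2 : GM.ball v m = (box d m).image (· + v) := rfl
        rw [e1, e2, real_linkIn_image_add]
        exact hface M (le_max_left _ _) a τ
      · exact measurableSet_linkIn _ _ _
    -- (3) the target route
    have h3 : 1 - δ ^ 2 < μ.real (linkIn (↑(g.Qset ℓ v)) (GM.ball v m) (g.Fset ℓ v)) := by
      rw [hμ, hsub.real_eq_bondPercolation (determinedBy_linkIn _ _ _ (wireSet_mono (Finset.coe_subset.2 hQ)))
        (measurableSet_linkIn _ _ _)]
      have e2 : GM.ball v m = (box d m).image (· + v) := rfl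
      rw [g.Qset_eq_image ℓ v, g.Fset_eq_image ℓ v, e2, real_linkIn_image_add]
      exact hklspec g hg m ((hk₀le g hg).trans hmk₀) ℓ ((hℓle g hg).trans (by omega))
    exact stepIV_in (S := S) hsub hF hQ hmM hballS (LData.ufaceX_subset_innerBoundary hwide hx)
      (g.disjoint_Fset_ball hMℓ v) hδpos (Rg := (↑D : Set (Site d))) hballD (Finset.coe_subset.2 hQ) h1 h2 h3
  -- the kit at level `j`
  exact ⟨zdSeedKit L j M k, S, shyp_zdSeedKit L k hwide, le_rfl, hk.le, hSX, hSD,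
    fun x hx e he => seedE_not_mem_wireSet_shell hwide hS hx he, hUS, hIV⟩

/-- **KN's Lemma 12 on `ℤ^d` from the levels target property** (the exact conclusion of `CData.corridorLemma_of_target`): the `ℤ^d` regression of
the corridor lemma through the generic route. [cite: KozmaNitzan2024, §4 Lemma 12 (pp. 23–25)] -/
theorem corridorLemma_of_levels [NeZero d] (p : unitInterval) (hp0 : 0 < (p : ℝ)) (hp1 : (p : ℝ) < 1)
    (hθ : 0 < theta (zdGraph d) (0 : Site d) p) (hT : KNLevels.TargetProperty (zdGraph d) (2 * d) p) {ε : ℝ} (hε : 0 < ε) :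
    ∃ δ : ℝ, 0 < δ ∧ ∃ m : ℕ, ∀ S : CData d, S.Hyp p → m ≤ S.r →
      1 - δ < (prodBernoulli S.W).real
          (⋃ b ∈ Finset.Icc (S.c - ((3 * S.r : ℕ) : Site d)) (S.c + ((3 * S.r : ℕ) : Site d)),
            openConnIn (↑S.Aset : Set (Site d)) S.o b) →
        1 - ε < (prodBernoulli S.W).real (⋃ b ∈ S.Tn (3 * S.r), openConnIn (↑S.Uset : Set (Site d)) S.o b) :=
  CData.corridorLemma_of_target p (targetPropertyZd_of_levels p hp0 hp1 hθ hT) hp1 hθ hε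

/-- **KN's Lemma 11 on `ℤ^d` from the levels target property**: the elongated geometries are hittable. [cite: KozmaNitzan2024, §4 Lemma 11 (p. 22)] -/
theorem isHittable_elongGeom_of_levels [NeZero d] (p : unitInterval) (hp0 : 0 < (p : ℝ)) (hp1 : (p : ℝ) < 1)
    (hθ : 0 < theta (zdGraph d) (0 : Site d) p) (hT : KNLevels.TargetProperty (zdGraph d) (2 * d) p)
    (a : Fin d) (σ : ℤˣ) (K : ℕ) (hK : 2 ≤ K) : IsHittable p (elongGeom a σ K (by omega)) :=
  isHittable_elongGeom_of_target p (targetPropertyZd_of_levels p hp0 hp1 hθ hT) hp1 hθ a σ K hK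

/-- KN's Lemma 11 for the whole list of elongated geometries, from the levels target property. [cite: KozmaNitzan2024, §4 Lemma 11 (p. 22)] -/
theorem isHittable_of_mem_elongList_of_levels [NeZero d] (p : unitInterval) (hp0 : 0 < (p : ℝ)) (hp1 : (p : ℝ) < 1)
    (hθ : 0 < theta (zdGraph d) (0 : Site d) p) (hT : KNLevels.TargetProperty (zdGraph d) (2 * d) p)
    (K : ℕ) (hK : 2 ≤ K) : ∀ g ∈ elongList d K (by omega), IsHittable p g :=
  isHittable_of_mem_elongList_of_target p (targetPropertyZd_of_levels p hp0 hp1 hθ hT) hp1 hθ K hK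

end Transplant

end Summit.CriticalPhenomena.PercolationContinuityZ3.Theorems
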